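import Summits.HodgeConjecture.CorCM.Census.CyclicCharacterFibreWalk
import Summits.HodgeConjecture.CorCM.Census.TwistTwoColumnPrep

/-!
# Cyclic characters, XVII: NEAR LINEARISATION FROM ANY COVER — closing relations without an explicit cover

COR-CM (cell `pub-hodgecm2`), count-neutral kernel combinatorics by the binder seat b09 (gen 42; lane CYCLIC-CHARACTER FIBRE LAW, part XVII), on part XIV
(`Census/CyclicCharacterFibreWalk.lean`: local linearisation, normal forms), gen 38ʼs base-block potential (`Census/BaseBlockCovering.lean`: `bpot`, `bpot_le`,
`exists_bpot_eq`) and the «toward» property delivered by EVERY cover (`Census/BaseBlockCoveringOn.lean`: `exists_joint_cover_on`, `hcov_of_toward`), and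
`TwistGeneration.ddist_comm` BY NAME.  Theorems only (no definition, no `decide`, no certificate, no named fact, no `sorry`).
HONEST FRAMING: `HC_CM` is NOT proved, here or anywhere in the tree; nothing here is a period or a headline.

THE PROBLEM IT SOLVES.  After parts XII–XVI a column of the class owes only the near-zone relations (the arc-shift vectors `Y(s)` and the fibre-sum vector
(W2)) inside `ℤ⟨pairs⟩ + ℤ[G]·S₀`.  They must come from the closing faces THROUGH the cover, but gen 38ʼs cover is abstract (`exists_cover`: one unnamed
«toward» face per far block), so its reductions have unknown values — EXCEPT near the arc block: a type `Φ` at distance `< |ker w|/2` from an arc type `T`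
has `T` as its UNIQUE nearest arc type (§2: two distinct arc types are `≥ |ker w|` apart, `card_sdiff_rt_arcType_ge`; triangle inequality `ddist_triangle`), so
every «toward» face at `Φ` flips two deviation places of `Φ` from `T`, and the local linearisation of part XIV runs on the towards faces of ANY cover:

* §3 **ONE-SIDED LINEARISATION FROM THE TOWARD PROPERTY** (`single_sub_normalForm_mem_of_toward`): if `L` has a toward face through every type of potential
  `≥ 2` (the property every cover supplies, for every `L ⊇ ℤ⟨its base changes⟩`) then for every arc type `T = T_0·Q₀⁻¹` and every `Φ` with
  `2·|T ∖ Φ| < |ker w|`:  `[Φ] ≡ [T] + Σ_{t ∈ T∖Φ} ([T^{(t)}] − [T])  (mod L)`.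
* §4 **STRADDLING FACES GIVE NEAR-ZONE RELATIONS** (`alt_normalForm_mem_of_gface_mem`): if moreover a face `[Ψ] + [Ψ^{(tt')}] − [Ψ^{(t)}] − [Ψ^{(t')}]` lies in
  `L` and each of its four corners is within half a fibre of some arc type (possibly different ones — an EQUATOR face of a walk), then the alternating sum
  of the four normal forms lies in `L`: an explicit relation among arc types and single flips, obtained WITHOUT knowing the cover.  This is how the `2ᵏ⁻¹`
  closing faces of a certificate are to be cashed into the arc-shift and fibre-sum relations of part XVI (numerics `HOME/pub-hodgecm2-b09/lean-g42/py/mechanism.py`: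
  in `Dic₅` the two greedy closing faces are equator faces of the bottom and top walks, with residues `−(3 bottom flips of T_0) + (2 top flips of T_1) + 2[T_0] − [T_1]`).

## References
* [Pohlmann1968] H. Pohlmann, Algebraic cycles on abelian varieties of complex multiplication type, Ann. of Math. 88 (1968), Thm 1.
* [Milne1999] J. S. Milne, Lefschetz motives and the Tate conjecture, Compositio Math. 117 (1999), Prop. 2.1, p. 54.
-/

namespace Summit.HodgeConjecture.CorCM.Census.CyclicCharacter

open Finset
open Summit.HodgeConjecture.CorCM.Prior.AllgGroup.RfwfAllgGroup
open Summit.HodgeConjecture.CorCM.Census.BlockParity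
open Summit.HodgeConjecture.CorCM.Census.Coinvariant
open Summit.HodgeConjecture.CorCM.Census.TwistGeneration
open Summit.HodgeConjecture.CorCM.Census.Nondegenerate
open Summit.HodgeConjecture.CorCM.Census.BaseBlock

noncomputable section

variable {G : Type*} [Group G] [Fintype G] [DecidableEq G] {k : ℕ} {w : G → ZMod (2 ^ k)} {c : G}

/-! ## §1 The deviation distance is a metric on CM types -/

/-- **Triangle inequality** for the deviation distance `ddist T Ψ = |T ∖ Ψ|`. [folklore] -/
theorem ddist_triangle (T Ψ Ω : CMF G c) : ddist T Ω ≤ ddist T Ψ + ddist Ψ Ω := by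
  unfold ddist
  calc (T.1 \ Ω.1).card ≤ ((T.1 \ Ψ.1) ∪ (Ψ.1 \ Ω.1)).card := card_le_card fun x hx => by
          rw [mem_union, mem_sdiff, mem_sdiff]; rw [mem_sdiff] at hx; tauto
    _ ≤ (T.1 \ Ψ.1).card + (Ψ.1 \ Ω.1).card := card_union_le _ _

/-- `ddist T Ψ = 0 ↔ T = Ψ`. [folklore] -/
theorem ddist_eq_zero_iff (T Ψ : CMF G c) : ddist T Ψ = 0 ↔ T = Ψ := by
  constructor
  · intro h
    exact (eq_of_dev_empty c (Finset.card_eq_zero.mp h)).symm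
  · rintro rfl; exact ddist_self T

/-! ## §2 Two distinct arc types are a whole fibre apart; uniqueness of the nearest arc type -/

/-- **`T_0 ∖ T_0·Q⁻¹` is a union of whole fibres**: with a point it contains the point's fibre. [folklore] -/
theorem mul_mem_sdiff_rt_arcType (hw : ∀ P Q : G, w (P * Q) = w P + w Q) (hk : 1 ≤ k) (hc2 : c * c = 1) (hwc : w c ≠ 0) (Q : G) {P n : G}
    (hP : P ∈ (arcType hw hk hc2 hwc 0).1 \ (rt c Q (arcType hw hk hc2 hwc 0)).1) (hn : w n = 0) :
    P * n ∈ (arcType hw hk hc2 hwc 0).1 \ (rt c Q (arcType hw hk hc2 hwc 0)).1 := by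
  rw [rt_arcType] at hP ⊢
  rw [mem_sdiff, mem_arcType, mem_arcType, hw, hn, add_zero] at *
  exact hP

/-- **Two distinct arc types are at least a fibre apart**: `T_0·Q⁻¹ ≠ T_0 ⟹ |ker w| ≤ ddist T_0 (T_0·Q⁻¹)`. [folklore] -/
theorem card_ker_le_ddist_arcType_rt (hw : ∀ P Q : G, w (P * Q) = w P + w Q) (hk : 1 ≤ k) (hc2 : c * c = 1) (hwc : w c ≠ 0) {Q : G}
    (hQ : rt c Q (arcType hw hk hc2 hwc 0) ≠ arcType hw hk hc2 hwc 0) :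
    (univ.filter fun n : G => w n = 0).card ≤ ddist (arcType hw hk hc2 hwc 0) (rt c Q (arcType hw hk hc2 hwc 0)) := by
  have hne : ((arcType hw hk hc2 hwc 0).1 \ (rt c Q (arcType hw hk hc2 hwc 0)).1).Nonempty := by
    rw [nonempty_iff_ne_empty]
    intro h
    exact hQ (eq_of_dev_empty c h)
  obtain ⟨P, hP⟩ := hne
  unfold ddist
  calc (univ.filter fun n : G => w n = 0).card = ((univ.filter fun n : G => w n = 0).image fun n => P * n).card :=
        (card_image_of_injective _ (mul_right_injective P)).symm
    _ ≤ _ := card_le_card fun x hx => by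
        obtain ⟨n, hn, rfl⟩ := mem_image.mp hx
        exact mul_mem_sdiff_rt_arcType hw hk hc2 hwc Q hP (mem_filter.mp hn).2

/-- **UNIQUENESS OF THE NEAREST ARC TYPE**: if `2·ddist (T_0·Q₀⁻¹) Φ < |ker w|` then every arc type realising the potential of `Φ` equals `T_0·Q₀⁻¹`. [folklore] -/
theorem rt_arcType_eq_of_bpot_eq (hw : ∀ P Q : G, w (P * Q) = w P + w Q) (hk : 1 ≤ k) (hc2 : c * c = 1) (hwc : w c ≠ 0) {Q₀ Q : G}
    {Φ : CMF G c} (hΦ : 2 * ddist (rt c Q₀ (arcType hw hk hc2 hwc 0)) Φ < (univ.filter fun n : G => w n = 0).card)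
    (hQ : bpot c (arcType hw hk hc2 hwc 0) Φ = ddist (rt c Q (arcType hw hk hc2 hwc 0)) Φ) :
    rt c Q (arcType hw hk hc2 hwc 0) = rt c Q₀ (arcType hw hk hc2 hwc 0) := by
  set T₀ := arcType hw hk hc2 hwc 0 with hT₀
  by_contra hne
  have hA : rt c Q T₀ = rt c Q₀ (rt c (Q₀⁻¹ * Q) T₀) := by rw [← rt_mul, mul_inv_cancel_left]
  have hne' : rt c (Q₀⁻¹ * Q) T₀ ≠ T₀ := fun h => hne (by rw [hA, h])
  have hfar : (univ.filter fun n : G => w n = 0).card ≤ ddist T₀ (rt c (Q₀⁻¹ * Q) T₀) :=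
    card_ker_le_ddist_arcType_rt hw hk hc2 hwc hne'
  have e : ddist (rt c Q₀ T₀) (rt c Q T₀) = ddist T₀ (rt c (Q₀⁻¹ * Q) T₀) := by rw [hA, ddist_rt]
  have htri := ddist_triangle (rt c Q₀ T₀) Φ (rt c Q T₀)
  rw [e, ddist_comm hc2 Φ (rt c Q T₀)] at htri
  have h1 : ddist (rt c Q T₀) Φ ≤ ddist (rt c Q₀ T₀) Φ := by rw [← hQ]; exact bpot_le c _ Φ Q₀
  omega

/-- **Near an arc type the potential is the distance to it**: `2·ddist (T_0·Q₀⁻¹) Φ < |ker w| ⟹ bpot Φ = ddist (T_0·Q₀⁻¹) Φ`. [folklore] -/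
theorem bpot_eq_ddist_of_near (hw : ∀ P Q : G, w (P * Q) = w P + w Q) (hk : 1 ≤ k) (hc2 : c * c = 1) (hwc : w c ≠ 0) {Q₀ : G}
    {Φ : CMF G c} (hΦ : 2 * ddist (rt c Q₀ (arcType hw hk hc2 hwc 0)) Φ < (univ.filter fun n : G => w n = 0).card) :
    bpot c (arcType hw hk hc2 hwc 0) Φ = ddist (rt c Q₀ (arcType hw hk hc2 hwc 0)) Φ := by
  obtain ⟨Q, hQ⟩ := exists_bpot_eq c (arcType hw hk hc2 hwc 0) Φ
  rw [hQ, rt_arcType_eq_of_bpot_eq hw hk hc2 hwc hΦ hQ]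

/-! ## §3 One-sided linearisation from the toward property of any cover -/

/-- **ONE-SIDED LINEARISATION FROM THE TOWARD PROPERTY**, `thetaG` form: if `L` has a toward face through every type of potential `≥ 2`, then for the arc
type `T = T_0·Q₀⁻¹` and every `Φ` with `2·|T ∖ Φ| < |ker w|`, `[Φ] − θ_T(1_Φ) ∈ L`. [folklore] -/
theorem single_sub_thetaG_mem_of_toward (hw : ∀ P Q : G, w (P * Q) = w P + w Q) (hk : 1 ≤ k) (hc2 : c * c = 1) (hwc : w c ≠ 0)
    (L : Submodule ℤ (CMF G c →₀ ℤ))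
    (htw : ∀ Φ : CMF G c, 2 ≤ bpot c (arcType hw hk hc2 hwc 0) Φ → ∃ Q t t' : G,
      bpot c (arcType hw hk hc2 hwc 0) Φ = ddist (rt c Q (arcType hw hk hc2 hwc 0)) Φ ∧
        t ∈ (rt c Q (arcType hw hk hc2 hwc 0)).1 \ Φ.1 ∧ t' ∈ (rt c Q (arcType hw hk hc2 hwc 0)).1 \ Φ.1 ∧ t ≠ t' ∧ gface c hc2 Φ t t' ∈ L)
    (Q₀ : G) :
    ∀ (m : ℕ) (Φ : CMF G c), (rt c Q₀ (arcType hw hk hc2 hwc 0)).1 \ Φ.1 = (rt c Q₀ (arcType hw hk hc2 hwc 0)).1 \ Φ.1 →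
      ((rt c Q₀ (arcType hw hk hc2 hwc 0)).1 \ Φ.1).card = m → 2 * m < (univ.filter fun n : G => w n = 0).card →
      Finsupp.single Φ (1 : ℤ) - thetaG c hc2 (rt c Q₀ (arcType hw hk hc2 hwc 0)) (typeSum G c (Finsupp.single Φ 1)) ∈ L := by
  set T := rt c Q₀ (arcType hw hk hc2 hwc 0) with hT
  intro m
  induction m using Nat.strong_induction_on with
  | h m ih =>
  intro Φ _ hm hlt
  rcases m with _ | (_ | m)
  · have hΦ : Φ = T := eq_of_dev_empty c (Finset.card_eq_zero.mp hm)
    rw [hΦ, thetaG_typeSum_single, sdiff_self, Finset.bot_eq_empty, Finset.sum_empty, zero_add, sub_self]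
    exact Submodule.zero_mem _
  · obtain ⟨s, hs⟩ := Finset.card_eq_one.mp hm
    have hd : Φ = oflipCM c hc2 s T := eq_oflip_of_dev_singleton c hc2 hs
    rw [thetaG_typeSum_single, hs, Finset.sum_singleton, hd, sub_add_cancel, sub_self]
    exact Submodule.zero_mem _
  · -- potential `m + 2 ≥ 2`, realised only by `T`: the cover's toward face flips two deviation places from `T`
    have hdd : ddist T Φ = m + 2 := hm
    have hnear : 2 * ddist T Φ < (univ.filter fun n : G => w n = 0).card := by rw [hdd]; exact hlt
    have hbpot : bpot c (arcType hw hk hc2 hwc 0) Φ = m + 2 := by rw [← hdd]; exact bpot_eq_ddist_of_near hw hk hc2 hwc hnear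
    obtain ⟨Q, s, s', hQ, hsD, hs'D, hss', hface⟩ := htw Φ (by omega)
    have hQT : rt c Q (arcType hw hk hc2 hwc 0) = T := rt_arcType_eq_of_bpot_eq hw hk hc2 hwc hnear hQ
    rw [hQT] at hsD hs'D
    have hsT : s ∈ T.1 := (Finset.mem_sdiff.mp hsD).1
    have hsΦ : s ∉ Φ.1 := (Finset.mem_sdiff.mp hsD).2
    have hs'T : s' ∈ T.1 := (Finset.mem_sdiff.mp hs'D).1
    have hs'Φ : s' ∉ Φ.1 := (Finset.mem_sdiff.mp hs'D).2
    have hs'O : s' ∉ orb c s := by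
      rw [mem_orb]
      rintro (h1 | h1)
      · exact hss' h1.symm
      · exact ((T.2 s).mp hsT) (h1 ▸ hs'T)
    have hdev1 : (T.1 \ (oflipCM c hc2 s Φ).1).card = m + 1 := by
      rw [dev_oflip c hc2 hsT hsΦ, Finset.card_erase_of_mem hsD]; omega
    have hdev2 : (T.1 \ (oflipCM c hc2 s' Φ).1).card = m + 1 := by
      rw [dev_oflip c hc2 hs'T hs'Φ, Finset.card_erase_of_mem hs'D]; omega
    have hsflip : s ∉ (oflipCM c hc2 s' Φ).1 := by
      show s ∉ oflip c s' Φ.1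
      have hsO' : s ∉ orb c s' := by
        rw [mem_orb]
        rintro (h1 | h1)
        · exact hss' h1
        · exact ((T.2 s').mp hs'T) (h1 ▸ hsT)
      intro hmem
      rw [oflip, Finset.mem_symmDiff] at hmem
      rcases hmem with ⟨h1, -⟩ | ⟨h1, -⟩
      · exact hsΦ h1
      · exact hsO' h1
    have hdev3 : (T.1 \ (oflipCM c hc2 s (oflipCM c hc2 s' Φ)).1).card = m := by
      rw [dev_oflip c hc2 hsT hsflip, dev_oflip c hc2 hs'T hs'Φ, Finset.card_erase_of_mem (Finset.mem_erase.mpr ⟨hss', hsD⟩),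
        Finset.card_erase_of_mem hs'D]
      omega
    have key : Finsupp.single Φ (1 : ℤ) - thetaG c hc2 T (typeSum G c (Finsupp.single Φ 1))
        = (gface c hc2 Φ s s'
            - thetaG c hc2 T (typeSum G c (gface c hc2 Φ s s')))
          + (Finsupp.single (oflipCM c hc2 s Φ) (1 : ℤ)
              - thetaG c hc2 T (typeSum G c (Finsupp.single (oflipCM c hc2 s Φ) 1)))
          + (Finsupp.single (oflipCM c hc2 s' Φ) (1 : ℤ)
              - thetaG c hc2 T (typeSum G c (Finsupp.single (oflipCM c hc2 s' Φ) 1)))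
          - (Finsupp.single (oflipCM c hc2 s (oflipCM c hc2 s' Φ)) (1 : ℤ)
              - thetaG c hc2 T (typeSum G c (Finsupp.single (oflipCM c hc2 s (oflipCM c hc2 s' Φ)) 1))) := by
      simp only [gface, map_add, map_sub]
      abel
    rw [key]
    refine Submodule.sub_mem _ (Submodule.add_mem _ (Submodule.add_mem _ ?_ ?_) ?_) ?_
    · rw [typeSum_gface c hc2 Φ hs'O, map_zero, sub_zero]
      exact hface
    · exact ih (m + 1) (by omega) _ rfl hdev1 (by omega)
    · exact ih (m + 1) (by omega) _ rfl hdev2 (by omega)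
    · exact ih m (by omega) _ rfl hdev3 (by omega)

/-- **ONE-SIDED LINEARISATION FROM THE TOWARD PROPERTY**, normal form: under the toward property, for `T = T_0·Q₀⁻¹` and `2·|T ∖ Φ| < |ker w|`,
`[Φ] − ([T] + Σ_{t ∈ T∖Φ} ([T^{(t)}] − [T])) ∈ L` — the cover may stay abstract. [folklore] -/
theorem single_sub_normalForm_mem_of_toward (hw : ∀ P Q : G, w (P * Q) = w P + w Q) (hk : 1 ≤ k) (hc2 : c * c = 1) (hwc : w c ≠ 0)
    (L : Submodule ℤ (CMF G c →₀ ℤ))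
    (htw : ∀ Φ : CMF G c, 2 ≤ bpot c (arcType hw hk hc2 hwc 0) Φ → ∃ Q t t' : G,
      bpot c (arcType hw hk hc2 hwc 0) Φ = ddist (rt c Q (arcType hw hk hc2 hwc 0)) Φ ∧
        t ∈ (rt c Q (arcType hw hk hc2 hwc 0)).1 \ Φ.1 ∧ t' ∈ (rt c Q (arcType hw hk hc2 hwc 0)).1 \ Φ.1 ∧ t ≠ t' ∧ gface c hc2 Φ t t' ∈ L)
    (Q₀ : G) (Φ : CMF G c) (hΦ : 2 * ddist (rt c Q₀ (arcType hw hk hc2 hwc 0)) Φ < (univ.filter fun n : G => w n = 0).card) :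
    Finsupp.single Φ (1 : ℤ) - ((∑ t ∈ (rt c Q₀ (arcType hw hk hc2 hwc 0)).1 \ Φ.1,
      (Finsupp.single (oflipCM c hc2 t (rt c Q₀ (arcType hw hk hc2 hwc 0))) (1 : ℤ) - Finsupp.single (rt c Q₀ (arcType hw hk hc2 hwc 0)) 1)) +
        Finsupp.single (rt c Q₀ (arcType hw hk hc2 hwc 0)) 1) ∈ L := by
  rw [← thetaG_typeSum_single hc2]
  exact single_sub_thetaG_mem_of_toward hw hk hc2 hwc L htw Q₀ _ Φ rfl rfl hΦ

/-! ## §4 Straddling faces give near-zone relations -/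

/-- **A FACE IN `L` WHOSE CORNERS ARE NEAR ARC TYPES YIELDS A NEAR-ZONE RELATION**: the alternating sum of the four normal forms (each corner linearised
w.r.t. its own near arc type — an EQUATOR face may use `T_0` for some corners and `T_1` for the others) lies in `L`.  No knowledge of the cover beyond its
toward property is used. [folklore] -/
theorem alt_normalForm_mem_of_gface_mem (hw : ∀ P Q : G, w (P * Q) = w P + w Q) (hk : 1 ≤ k) (hc2 : c * c = 1) (hwc : w c ≠ 0)
    (L : Submodule ℤ (CMF G c →₀ ℤ))
    (htw : ∀ Φ : CMF G c, 2 ≤ bpot c (arcType hw hk hc2 hwc 0) Φ → ∃ Q t t' : G,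
      bpot c (arcType hw hk hc2 hwc 0) Φ = ddist (rt c Q (arcType hw hk hc2 hwc 0)) Φ ∧
        t ∈ (rt c Q (arcType hw hk hc2 hwc 0)).1 \ Φ.1 ∧ t' ∈ (rt c Q (arcType hw hk hc2 hwc 0)).1 \ Φ.1 ∧ t ≠ t' ∧ gface c hc2 Φ t t' ∈ L)
    {Ψ : CMF G c} {t t' : G} (hf : gface c hc2 Ψ t t' ∈ L) (Q₁ Q₂ Q₃ Q₄ : G)
    (h₁ : 2 * ddist (rt c Q₁ (arcType hw hk hc2 hwc 0)) Ψ < (univ.filter fun n : G => w n = 0).card)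
    (h₂ : 2 * ddist (rt c Q₂ (arcType hw hk hc2 hwc 0)) (oflipCM c hc2 t (oflipCM c hc2 t' Ψ)) < (univ.filter fun n : G => w n = 0).card)
    (h₃ : 2 * ddist (rt c Q₃ (arcType hw hk hc2 hwc 0)) (oflipCM c hc2 t Ψ) < (univ.filter fun n : G => w n = 0).card)
    (h₄ : 2 * ddist (rt c Q₄ (arcType hw hk hc2 hwc 0)) (oflipCM c hc2 t' Ψ) < (univ.filter fun n : G => w n = 0).card) :
    (((∑ s ∈ (rt c Q₁ (arcType hw hk hc2 hwc 0)).1 \ Ψ.1,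
        (Finsupp.single (oflipCM c hc2 s (rt c Q₁ (arcType hw hk hc2 hwc 0))) (1 : ℤ) - Finsupp.single (rt c Q₁ (arcType hw hk hc2 hwc 0)) 1)) +
          Finsupp.single (rt c Q₁ (arcType hw hk hc2 hwc 0)) 1) +
      ((∑ s ∈ (rt c Q₂ (arcType hw hk hc2 hwc 0)).1 \ (oflipCM c hc2 t (oflipCM c hc2 t' Ψ)).1,
        (Finsupp.single (oflipCM c hc2 s (rt c Q₂ (arcType hw hk hc2 hwc 0))) (1 : ℤ) - Finsupp.single (rt c Q₂ (arcType hw hk hc2 hwc 0)) 1)) +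
          Finsupp.single (rt c Q₂ (arcType hw hk hc2 hwc 0)) 1)) -
      ((∑ s ∈ (rt c Q₃ (arcType hw hk hc2 hwc 0)).1 \ (oflipCM c hc2 t Ψ).1,
        (Finsupp.single (oflipCM c hc2 s (rt c Q₃ (arcType hw hk hc2 hwc 0))) (1 : ℤ) - Finsupp.single (rt c Q₃ (arcType hw hk hc2 hwc 0)) 1)) +
          Finsupp.single (rt c Q₃ (arcType hw hk hc2 hwc 0)) 1) -
      ((∑ s ∈ (rt c Q₄ (arcType hw hk hc2 hwc 0)).1 \ (oflipCM c hc2 t' Ψ).1,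
        (Finsupp.single (oflipCM c hc2 s (rt c Q₄ (arcType hw hk hc2 hwc 0))) (1 : ℤ) - Finsupp.single (rt c Q₄ (arcType hw hk hc2 hwc 0)) 1)) +
          Finsupp.single (rt c Q₄ (arcType hw hk hc2 hwc 0)) 1) ∈ L := by
  have e1 := single_sub_normalForm_mem_of_toward hw hk hc2 hwc L htw Q₁ Ψ h₁
  have e2 := single_sub_normalForm_mem_of_toward hw hk hc2 hwc L htw Q₂ _ h₂
  have e3 := single_sub_normalForm_mem_of_toward hw hk hc2 hwc L htw Q₃ _ h₃
  have e4 := single_sub_normalForm_mem_of_toward hw hk hc2 hwc L htw Q₄ _ h₄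
  have h := Submodule.sub_mem _ (Submodule.sub_mem _ hf (Submodule.add_mem _ e1 e2)) (Submodule.neg_mem _ (Submodule.add_mem _ e3 e4))
  -- `gface − (([Ψ] − N₁) + ([Ψ''] − N₂)) + (([Ψᵗ] − N₃) + ([Ψᵗ'] − N₄)) = N₁ + N₂ − N₃ − N₄`
  convert h using 1
  simp only [gface]
  abel

end

end Summit.HodgeConjecture.CorCM.Census.CyclicCharacter
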